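import Literature.Probability.LatticeModels.ScaleFrame
import Literature.Probability.Percolation.Crossings
import Literature.Probability.Percolation.PlanarDuality
import Literature.Probability.Percolation.RSW
import HarnessLib

/-!
# Gluing arms, separators and a radial crossing on a scale frame (proved)

Topic `Literature/Probability/LatticeModels` (trunk `StatMech`, family `crit-ising`). The deterministic
half of Kesten's gluing step in the quasi-multiplicativity of two-arm connection probabilities
(H. Kesten, PTRF 73 (1986), §2, eqs. (29)–(30)) on an abstract `ScaleFrame` (no planarity: occupied
circuits are replaced by open SEPARATORS `sepEvent`): walk tools (`exists_walk_firstHit`,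
`exists_edge_end`, `mem_outSet_iff_of_lt`); `openCrossing_of_arms_seps_radCross` (inner arm, separator,
radial crossing, separator, outer arm glue to an open connection inside `W ⊇ annSet s₁ s₃`);
`inter_mem_openCrossing_core_iff` (an arm event read inside a region agrees on lattice configurations
with the arm event read inside its core — the "determined inside the core" input of boundary pushing);
`mem_radCross_of_core_walk_up` / `_down` (the collar crossings of the boundary-pushing toolkit are
radial crossings of the frame). Everything is proved; no definitions.

## References
* [Kesten1986] H. Kesten, Probab. Theory Related Fields 73 (1986) 369–394, §2 eqs. (28)–(30).
* [BasuSapozhnikov2017ECP] D. Basu, A. Sapozhnikov, ECP 22 (2017) no. 26, §2.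
-/

noncomputable section

open Finset SimpleGraph
open Literature.Probability.Percolation (BondConfig openConnIn openCrossing openGraph
  mem_openConnIn_of_walk exists_walk_of_mem_openConnIn mem_openConnIn_of_mem_support openConnIn_comm
  openConnIn_mono openCrossing_mono isUpperSet_openCrossing)

namespace Literature.Probability.LatticeModels

variable {V : Type*}

/-! ### Walk tools -/

section Walks

variable {G : SimpleGraph V}

/-- **First visit of a walk to a vertex set**: a walk ending in `Q` has an initial piece (same
start, support and edges contained in the original ones) ending in `Q` whose only vertex in `Q` is
its endpoint. [folklore] -/
theorem ScaleFrame.exists_walk_firstHit (Q : Set V) :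
    ∀ {u v : V} (w : G.Walk u v), v ∈ Q → ∃ (b : V) (w' : G.Walk u b), b ∈ Q ∧
      (∀ z ∈ w'.support, z ∈ Q → z = b) ∧ w'.support ⊆ w.support ∧ w'.edges ⊆ w.edges := by
  intro u v w
  induction w with
  | nil =>
    intro hv
    exact ⟨_, .nil, hv, fun z hz _ => by simpa using hz, fun z hz => hz, fun e he => he⟩
  | cons hadj w ih =>
    intro hv
    rename_i u x v'
    by_cases hu : u ∈ Q
    · refine ⟨u, .nil, hu, fun z hz _ => by simpa using hz, fun z hz => ?_, fun e he => by simp at he⟩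
      rw [Walk.support_nil, List.mem_singleton] at hz
      rw [hz]; exact Walk.start_mem_support _
    · obtain ⟨b, w', hb, hQ, hs, he⟩ := ih hv
      refine ⟨b, .cons hadj w', hb, fun z hz hzQ => ?_, fun z hz => ?_, fun e he' => ?_⟩
      · rw [Walk.support_cons, List.mem_cons] at hz
        rcases hz with rfl | hz
        · exact (hu hzQ).elim
        · exact hQ z hz hzQ
      · rw [Walk.support_cons, List.mem_cons] at hz ⊢
        rcases hz with rfl | hz
        · exact Or.inl rfl
        · exact Or.inr (hs hz)
      · rw [Walk.edges_cons, List.mem_cons] at he' ⊢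
        rcases he' with rfl | he'
        · exact Or.inl rfl
        · exact Or.inr (he he')

/-- **The last edge of a walk**: a walk between distinct vertices ends with an edge into its
endpoint. [folklore] -/
theorem ScaleFrame.exists_edge_end : ∀ {u v : V} (w : G.Walk u v), u ≠ v → ∃ z : V, s(z, v) ∈ w.edges
  | _, _, .nil, h => (h rfl).elim
  | _, _, .cons' u x v hadj w', _ => by
    by_cases hx : x = v
    · subst hx
      exact ⟨u, by simp⟩
    · obtain ⟨z, hz⟩ := ScaleFrame.exists_edge_end w' hx
      exact ⟨z, by simp [hz]⟩

/-- Open crossing events are symmetric in the two target sets. [folklore] -/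
theorem ScaleFrame.openCrossing_comm (S A B : Set V) :
    (openCrossing S A B : Set (BondConfig V)) = openCrossing S B A :=
  Set.ext fun _ => ⟨fun ⟨x, hx, y, hy, h⟩ => ⟨y, hy, x, hx, by rwa [openConnIn_comm]⟩,
    fun ⟨x, hx, y, hy, h⟩ => ⟨y, hy, x, hx, by rwa [openConnIn_comm]⟩⟩

end Walks

/-! ### Regions of a frame -/

namespace ScaleFrame

variable [Fintype V] [DecidableEq V] (F : ScaleFrame V)

/-- The outside of a genuine annulus `(s, s')`, `s < s'`, read through the radius: a vertex is
outside iff it is bad or has radius `≥ s'`. [cite: Kesten1986, §2] -/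
theorem mem_outSet_iff_of_lt {s s' : ℝ} (h : s < s') {v : V} :
    v ∈ F.outSet s s' ↔ (v ∈ F.good → s' ≤ F.rad v) := by
  rw [F.mem_outSet, Set.mem_union, F.mem_inSet, F.mem_annSet]
  constructor
  · intro hv hg
    by_contra hlt
    rcases le_or_gt (F.rad v) s with h1 | h1
    · exact hv (Or.inl ⟨hg, h1⟩)
    · exact hv (Or.inr ⟨hg, h1, lt_of_not_ge hlt⟩)
  · rintro hv (⟨hg, h1⟩ | ⟨hg, -, h2⟩)
    · exact absurd (h1.trans_lt h) (not_lt.2 (hv hg))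
    · exact absurd h2 (not_lt.2 (hv hg))

/-- Annuli are monotone in their scales. [cite: Kesten1986, §2] -/
theorem annSet_subset_annSet {s s' t t' : ℝ} (hs : s' ≤ s) (ht : t ≤ t') :
    F.annSet s t ⊆ F.annSet s' t' :=
  fun _ ⟨hg, h1, h2⟩ => ⟨hg, hs.trans_lt h1, h2.trans_le ht⟩

/-- The outside of a long annulus lies outside every shorter annulus ending below its outer scale.
[cite: Kesten1986, §2] -/
theorem outSet_subset_outSet {s s' t t' : ℝ} (hs : s < t) (hs' : s' < t') (htt : t' ≤ t) :
    F.outSet s t ⊆ F.outSet s' t' := fun _ hv =>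
  (F.mem_outSet_iff_of_lt hs').2 fun hg => htt.trans ((F.mem_outSet_iff_of_lt hs).1 hv hg)

/-- Separator events are increasing. [cite: Kesten1986, §2] -/
theorem isUpperSet_sepEvent (s s' : ℝ) : IsUpperSet (F.sepEvent s s') := by
  rintro ω ω' hle ⟨P, hP, hconn, hsep⟩
  exact ⟨P, hP, fun x hx y hy =>
    Literature.Probability.Percolation.isUpperSet_openConnIn _ x y hle (hconn x hx y hy), hsep⟩

/-- Radial-crossing events are increasing. [cite: Kesten1986, §2] -/
theorem isUpperSet_radCross (s s' : ℝ) : IsUpperSet (F.radCross s s') := by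
  rintro ω ω' hle ⟨x, y, w, hx, hy, hs, he⟩
  exact ⟨x, y, w, hx, hy, hs, fun e he' => hle (he e he')⟩

/-! ### Gluing (Kesten 1986, eqs. (29)–(30), deterministic part) -/

/-- **An inner arm meets the separator.** An open crossing inside `U ⊆ W` from `R ⊆ inSet s` to
`T ⊆ outSet s s'` (lattice configuration `ω ⊆ E(⟨E⟩)`) passes through every separator `P` of
`(s, s')`, so some `r ∈ R` is joined inside `W` to some vertex of `P`. [cite: Kesten1986, §2 eq. (29)] -/
theorem exists_openConnIn_sep_of_openCrossing_out {ω : BondConfig V} (hω : ω ⊆ F.graph.edgeSet)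
    {s s' : ℝ} {P : Set V}
    (hP : ∀ x y : V, x ∈ F.inSet s → y ∈ F.outSet s s' →
      ∀ w : F.graph.Walk x y, ∃ z ∈ w.support, z ∈ P)
    {U W R T : Set V} (hUW : U ⊆ W) (hR : ∀ r ∈ R, r ∈ F.inSet s)
    (hT : ∀ t ∈ T, t ∈ F.outSet s s') (h : ω ∈ openCrossing U R T) :
    ∃ r ∈ R, ∃ z ∈ P, ω ∈ openConnIn W r z := by
  obtain ⟨r, hr, t, ht, hrt⟩ := h
  obtain ⟨w, hwS, hwE⟩ := exists_walk_of_mem_openConnIn hω hrt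
  obtain ⟨z, hz, hzP⟩ := hP r t (hR r hr) (hT t ht) w
  exact ⟨r, hr, z, hzP, openConnIn_mono hUW r z (mem_openConnIn_of_mem_support w hwS hwE hz)⟩

/-- **An outer arm meets the separator.** An open crossing inside `U ⊆ W` from `S ⊆ inSet s` to
`Y ⊆ outSet s s'` passes through every separator `P` of `(s, s')`, so some vertex of `P` is joined
inside `W` to some `y ∈ Y`. [cite: Kesten1986, §2 eq. (29)] -/
theorem exists_openConnIn_sep_of_openCrossing_in {ω : BondConfig V} (hω : ω ⊆ F.graph.edgeSet)
    {s s' : ℝ} {P : Set V}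
    (hP : ∀ x y : V, x ∈ F.inSet s → y ∈ F.outSet s s' →
      ∀ w : F.graph.Walk x y, ∃ z ∈ w.support, z ∈ P)
    {U W S Y : Set V} (hUW : U ⊆ W) (hS : ∀ x ∈ S, x ∈ F.inSet s)
    (hY : ∀ y ∈ Y, y ∈ F.outSet s s') (h : ω ∈ openCrossing U S Y) :
    ∃ y ∈ Y, ∃ z ∈ P, ω ∈ openConnIn W z y := by
  obtain ⟨x, hx, y, hy, hxy⟩ := h
  obtain ⟨w, hwS, hwE⟩ := exists_walk_of_mem_openConnIn hω hxy
  obtain ⟨z, hz, hzP⟩ := hP x y (hS x hx) (hY y hy) w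
  refine ⟨y, hy, z, hzP, ?_⟩
  have hz' : z ∈ w.reverse.support := by
    rw [Walk.support_reverse]
    exact List.mem_reverse.2 hz
  have h1 : ω ∈ openConnIn U y z :=
    mem_openConnIn_of_mem_support w.reverse
      (fun v hv => hwS v (by rw [Walk.support_reverse] at hv; exact List.mem_reverse.1 hv))
      (fun e he => hwE e (by rw [Walk.edges_reverse] at he; exact List.mem_reverse.1 he)) hz'
  rw [openConnIn_comm] at h1
  exact openConnIn_mono hUW z y h1

/-- **The radial crossing joins the two separators.** An open radial crossing of the long annulus
`(s₁, s₃)` meets a separator `P₂ ⊆ annSet s₂ s₂'` and, before that, a separator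
`P₁ ⊆ annSet s₁ s₁'` (`s₁ < s₁' ≤ s₂ < s₂' ≤ s₃`); the piece of (a path extracted from) the crossing
between the two hits avoids the endpoints, hence runs in `annSet s₁ s₃ ⊆ W`.
[cite: Kesten1986, §2 eq. (30)] -/
theorem exists_openConnIn_sep_sep_of_radCross {ω : BondConfig V} {s₁ s₁' s₂ s₂' s₃ : ℝ}
    (h₁ : s₁ < s₁') (h₁₂ : s₁' ≤ s₂) (h₂ : s₂ < s₂') (h₂₃ : s₂' ≤ s₃)
    {P₁ P₂ : Set V} (hP₁sub : P₁ ⊆ F.annSet s₁ s₁')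
    (hP₁ : ∀ x y : V, x ∈ F.inSet s₁ → y ∈ F.outSet s₁ s₁' →
      ∀ w : F.graph.Walk x y, ∃ z ∈ w.support, z ∈ P₁)
    (hP₂sub : P₂ ⊆ F.annSet s₂ s₂')
    (hP₂ : ∀ x y : V, x ∈ F.inSet s₂ → y ∈ F.outSet s₂ s₂' →
      ∀ w : F.graph.Walk x y, ∃ z ∈ w.support, z ∈ P₂)
    {W : Set V} (hW : F.annSet s₁ s₃ ⊆ W) (h : ω ∈ F.radCross s₁ s₃) :
    ∃ z₁ ∈ P₁, ∃ z₂ ∈ P₂, ω ∈ openConnIn W z₁ z₂ := by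
  have hs₁₂ : s₁ ≤ s₂ := (h₁.trans_le h₁₂).le
  have h₁₃ : s₁ < s₃ := (h₁.trans_le h₁₂).trans_le (h₂.le.trans h₂₃)
  obtain ⟨x, y, w, hx, hy, hs, he⟩ := h
  -- pass to a path with the same endpoints
  set p := w.bypass with hp_def
  have hp : p.IsPath := w.bypass_isPath
  have hps : ∀ z ∈ p.support, z = x ∨ z = y ∨ z ∈ F.annSet s₁ s₃ := fun z hz =>
    hs z (w.support_bypass_subset_support hz)
  have hpe : ∀ e ∈ p.edges, e ∈ ω := fun e he' => he e (w.edges_bypass_subset_edges he')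
  have hy₁ : y ∈ F.outSet s₁ s₁' := F.outSet_subset_outSet h₁₃ h₁ (h₁₂.trans (h₂.le.trans h₂₃)) hy
  have hy₂ : y ∈ F.outSet s₂ s₂' := F.outSet_subset_outSet h₁₃ h₂ h₂₃ hy
  have hx₂ : x ∈ F.inSet s₂ := ⟨hx.1, hx.2.trans hs₁₂⟩
  -- the hit of `P₂`
  obtain ⟨z₂, hz₂, hz₂P⟩ := hP₂ x y hx₂ hy₂ p
  have hyz₂ : y ≠ z₂ := by
    rintro rfl
    exact (F.mem_outSet.1 hy₂) (Or.inr (hP₂sub hz₂P))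
  have hp₂ : (p.takeUntil z₂ hz₂).IsPath := hp.takeUntil hz₂
  have hy_p₂ : y ∉ (p.takeUntil z₂ hz₂).support := Walk.endpoint_notMem_support_takeUntil hp hz₂ hyz₂
  -- the hit of `P₁` before it
  have hz₂out : z₂ ∈ F.outSet s₁ s₁' := by
    obtain ⟨-, hr, -⟩ := hP₂sub hz₂P
    exact (F.mem_outSet_iff_of_lt h₁).2 fun _ => h₁₂.trans hr.le
  obtain ⟨z₁, hz₁, hz₁P⟩ := hP₁ x z₂ hx hz₂out (p.takeUntil z₂ hz₂)
  have hz₁r : z₁ ∈ (p.takeUntil z₂ hz₂).reverse.support := by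
    rw [Walk.support_reverse]
    exact List.mem_reverse.2 hz₁
  have hxz₁ : x ≠ z₁ := by
    rintro rfl
    exact Set.disjoint_left.1 (F.inSet_disjoint_annSet s₁ s₁') hx (hP₁sub hz₁P)
  set p₃ := (p.takeUntil z₂ hz₂).reverse.takeUntil z₁ hz₁r with hp₃_def
  have hx_p₃ : x ∉ p₃.support := Walk.endpoint_notMem_support_takeUntil hp₂.reverse hz₁r hxz₁
  have hsub₃ : ∀ z ∈ p₃.support, z ∈ (p.takeUntil z₂ hz₂).support := fun z hz => by
    have h1 := (p.takeUntil z₂ hz₂).reverse.support_takeUntil_subset_support hz₁r hz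
    rw [Walk.support_reverse] at h1
    exact List.mem_reverse.1 h1
  have hy_p₃ : y ∉ p₃.support := fun h => hy_p₂ (hsub₃ y h)
  have hp₃W : ∀ z ∈ p₃.support, z ∈ W := by
    intro z hz
    have hz' : z ∈ p.support := p.support_takeUntil_subset_support hz₂ (hsub₃ z hz)
    rcases hps z hz' with rfl | rfl | hzA
    · exact (hx_p₃ hz).elim
    · exact (hy_p₃ hz).elim
    · exact hW hzA
  have hp₃e : ∀ e ∈ p₃.edges, e ∈ ω := by
    intro e he'
    have h1 := (p.takeUntil z₂ hz₂).reverse.edges_takeUntil_subset_edges hz₁r he'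
    rw [Walk.edges_reverse] at h1
    exact hpe e (p.edges_takeUntil_subset_edges hz₂ (List.mem_reverse.1 h1))
  refine ⟨z₁, hz₁P, z₂, hz₂P, ?_⟩
  have h3 : ω ∈ openConnIn W z₂ z₁ := mem_openConnIn_of_walk p₃ hp₃W hp₃e
  rwa [openConnIn_comm] at h3

/-- **Kesten's gluing (deterministic part).** On a lattice configuration, an inner arm (open
crossing inside `U₁ ⊆ W` from `R ⊆ inSet s₁` to `T ⊆ outSet s₁ s₁'`), an open separator of
`(s₁, s₁')`, an open radial crossing of `(s₁, s₃)`, an open separator of `(s₂, s₂')` and an outer arm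
(open crossing inside `U₂ ⊆ W` from `S ⊆ inSet s₂` to `Y ⊆ outSet s₂ s₂'`), with
`s₁ < s₁' ≤ s₂ < s₂' ≤ s₃` and `annSet s₁ s₃ ⊆ W`, give an open connection `R ↔ Y` inside `W`.
[cite: Kesten1986, §2 eqs. (29)–(30)] -/
theorem openCrossing_of_arms_seps_radCross {ω : BondConfig V} (hω : ω ⊆ F.graph.edgeSet)
    {s₁ s₁' s₂ s₂' s₃ : ℝ} (h₁ : s₁ < s₁') (h₁₂ : s₁' ≤ s₂) (h₂ : s₂ < s₂') (h₂₃ : s₂' ≤ s₃)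
    {W U₁ U₂ R T S Y : Set V} (hU₁ : U₁ ⊆ W) (hU₂ : U₂ ⊆ W) (hW : F.annSet s₁ s₃ ⊆ W)
    (hR : ∀ r ∈ R, r ∈ F.inSet s₁) (hT : ∀ t ∈ T, t ∈ F.outSet s₁ s₁')
    (hS : ∀ x ∈ S, x ∈ F.inSet s₂) (hY : ∀ y ∈ Y, y ∈ F.outSet s₂ s₂')
    (hA₁ : ω ∈ openCrossing U₁ R T) (hS₁ : ω ∈ F.sepEvent s₁ s₁') (hRad : ω ∈ F.radCross s₁ s₃)
    (hS₂ : ω ∈ F.sepEvent s₂ s₂') (hA₂ : ω ∈ openCrossing U₂ S Y) :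
    ω ∈ openCrossing W R Y := by
  have hs₁₂ : s₁ ≤ s₂ := (h₁.trans_le h₁₂).le
  have h₁₃ : s₁' ≤ s₃ := h₁₂.trans (h₂.le.trans h₂₃)
  obtain ⟨P₁, hP₁sub, hP₁conn, hP₁sep⟩ := hS₁
  obtain ⟨P₂, hP₂sub, hP₂conn, hP₂sep⟩ := hS₂
  obtain ⟨r, hr, z₁, hz₁, c₁⟩ := F.exists_openConnIn_sep_of_openCrossing_out hω hP₁sep hU₁ hR hT hA₁
  obtain ⟨y, hy, z₂, hz₂, c₅⟩ := F.exists_openConnIn_sep_of_openCrossing_in hω hP₂sep hU₂ hS hY hA₂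
  obtain ⟨z₁', hz₁', z₂', hz₂', c₃⟩ :=
    F.exists_openConnIn_sep_sep_of_radCross h₁ h₁₂ h₂ h₂₃ hP₁sub hP₁sep hP₂sub hP₂sep hW hRad
  have c₂ : ω ∈ openConnIn W z₁ z₁' :=
    openConnIn_mono ((F.annSet_subset_annSet le_rfl h₁₃).trans hW) z₁ z₁' (hP₁conn z₁ hz₁ z₁' hz₁')
  have c₄ : ω ∈ openConnIn W z₂' z₂ :=
    openConnIn_mono ((F.annSet_subset_annSet hs₁₂ h₂₃).trans hW) z₂' z₂ (hP₂conn z₂' hz₂' z₂ hz₂)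
  exact ⟨r, hr, y, hy, Percolation.PlanarDuality.openConnIn_trans
    (Percolation.PlanarDuality.openConnIn_trans (Percolation.PlanarDuality.openConnIn_trans
      (Percolation.PlanarDuality.openConnIn_trans c₁ c₂) c₃) c₄) c₅⟩

/-! ### Arm events read inside the core (first-hit argument) -/

omit [Fintype V] in
/-- **An arm event is determined inside its core.** Let `⟨E'⟩` be a graph, `C ⊆ U` a core
containing `B₀`, every vertex of `U` off the target set `Q`, and every `U`-neighbour (along `E'`)
of such a vertex; let `T` contain every edge of `E'` inside `C`. Then on lattice configurations
`ω ⊆ E(⟨E'⟩)` the arm event "some vertex of `B₀` is joined inside `U` to `U ∩ Q`" holds iff it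
holds inside `C` for `ω ∩ T` (cut the open path at its first visit to `Q`).
[cite: Kesten1986, §2 (proof of (29))] -/
theorem inter_mem_openCrossing_core_iff {E' : Finset (Sym2 V)} {U C B₀ Q : Set V}
    {T : Set (Sym2 V)} (hCU : C ⊆ U) (hB₀ : B₀ ⊆ C) (hQC : ∀ x ∈ U, x ∉ Q → x ∈ C)
    (hstep : ∀ e ∈ E', ∀ x ∈ e, ∀ y ∈ e, x ∈ U → x ∉ Q → y ∈ U → y ∈ C)
    (hT : ∀ e ∈ E', (∀ x ∈ e, x ∈ C) → e ∈ T) {ω : BondConfig V}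
    (hω : ω ⊆ (fromEdgeSet (E' : Set (Sym2 V))).edgeSet) :
    ω ∈ openCrossing U B₀ (U ∩ Q) ↔ ω ∩ T ∈ openCrossing C B₀ (C ∩ Q) := by
  constructor
  · rintro ⟨r, hr, t, ⟨-, ht⟩, hrt⟩
    obtain ⟨w, hwU, hwω⟩ := exists_walk_of_mem_openConnIn hω hrt
    obtain ⟨b, w', hb, hQ, hsup, hed⟩ := ScaleFrame.exists_walk_firstHit Q w ht
    have hE' : ∀ e ∈ w'.edges, e ∈ E' := fun e he => by
      have h := w'.edges_subset_edgeSet he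
      rw [edgeSet_fromEdgeSet] at h
      exact Finset.mem_coe.1 h.1
    -- every vertex of the cut walk lies in the core
    have hC : ∀ z ∈ w'.support, z ∈ C := by
      intro z hz
      by_cases hzQ : z ∈ Q
      · obtain rfl := hQ z hz hzQ
        by_cases hrb : r = z
        · exact hrb ▸ hB₀ hr
        · obtain ⟨x, hx⟩ := ScaleFrame.exists_edge_end w' hrb
          have hxs : x ∈ w'.support := w'.fst_mem_support_of_mem_edges hx
          have hxz : x ≠ z := (fromEdgeSet (E' : Set (Sym2 V))).ne_of_adj (w'.edges_subset_edgeSet hx)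
          have hxQ : x ∉ Q := fun h => hxz (hQ x hxs h)
          exact hstep _ (hE' _ hx) x (Sym2.mem_mk_left x z) z (Sym2.mem_mk_right x z)
            (hwU x (hsup hxs)) hxQ (hwU z (hsup hz))
      · exact hQC z (hwU z (hsup hz)) hzQ
    refine ⟨r, hr, b, ⟨hC b w'.end_mem_support, hb⟩, mem_openConnIn_of_walk w' hC fun e he => ?_⟩
    exact ⟨hwω e (hed he), hT e (hE' e he) fun x hx => hC x (Walk.mem_support_of_mem_edges he hx)⟩
  · intro h
    exact isUpperSet_openCrossing _ _ _ (Set.inter_subset_left : ω ∩ T ⊆ ω)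
      (openCrossing_mono hCU le_rfl (Set.inter_subset_inter_left _ hCU) h)

/-! ### The collar radial crossings of the boundary-pushing toolkit are frame crossings -/

/-- **Core below a level.** For a graph `⟨E'⟩` of frame edges with endpoints in a set `U` of good
vertices and the core `C = U ∩ {rad ≤ s}`, an open `⟨E'⟩`-walk from `C` to the outside of
`C ∪ annSet s s'` through `annSet s s'` is an open radial crossing of `(s, s')`.
[cite: Kesten1986, §2 eq. (28)] -/
theorem mem_radCross_of_core_walk_up {E' : Finset (Sym2 V)} {U : Set V}
    (hE' : ∀ e ∈ E', e ∈ F.E ∧ ∀ x ∈ e, x ∈ U) (hU : ∀ u ∈ U, u ∈ F.good) {s s' : ℝ}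
    {ω : BondConfig V}
    (h : ∃ (x y : V) (w : (fromEdgeSet (E' : Set (Sym2 V))).Walk x y),
      x ∈ U ∩ {v | F.rad v ≤ s} ∧ y ∉ (U ∩ {v | F.rad v ≤ s}) ∪ F.annSet s s' ∧
        (∀ z ∈ w.support, z = x ∨ z = y ∨ z ∈ F.annSet s s') ∧ ∀ e ∈ w.edges, e ∈ ω) :
    ω ∈ F.radCross s s' := by
  obtain ⟨x, y, w, ⟨hxU, hxs⟩, hy, hs, he⟩ := h
  have hle : fromEdgeSet (E' : Set (Sym2 V)) ≤ F.graph := fun u v huv => by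
    rw [fromEdgeSet_adj] at huv
    exact (fromEdgeSet_adj _).2 ⟨Finset.mem_coe.2 (hE' _ (Finset.mem_coe.1 huv.1)).1, huv.2⟩
  have hxy : x ≠ y := fun hxy => hy (Or.inl (hxy ▸ ⟨hxU, hxs⟩))
  obtain ⟨z, hz⟩ := ScaleFrame.exists_edge_end w hxy
  have hyU : y ∈ U := by
    have h := w.edges_subset_edgeSet hz
    rw [edgeSet_fromEdgeSet] at h
    exact (hE' _ (Finset.mem_coe.1 h.1)).2 y (Sym2.mem_mk_right z y)
  have hyout : y ∈ F.outSet s s' := by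
    rw [F.mem_outSet]
    rintro (⟨-, hyr⟩ | hyA)
    · exact hy (Or.inl ⟨hyU, hyr⟩)
    · exact hy (Or.inr hyA)
  refine ⟨x, y, w.mapLe hle, ⟨hU x hxU, hxs⟩, hyout, ?_, ?_⟩
  · rw [Walk.support_mapLe_eq_support]; exact hs
  · rw [Walk.edges_mapLe_eq_edges]; exact he

/-- **Core above a level.** For a graph `⟨E'⟩` of frame edges with endpoints in a set `U` of good
vertices and the core `C = U ∩ {s' ≤ rad}`, `s < s'`, an open `⟨E'⟩`-walk from `C` to the outside
of `C ∪ annSet s s'` through `annSet s s'` is, reversed, an open radial crossing of `(s, s')`.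
[cite: Kesten1986, §2 eq. (28)] -/
theorem mem_radCross_of_core_walk_down {E' : Finset (Sym2 V)} {U : Set V}
    (hE' : ∀ e ∈ E', e ∈ F.E ∧ ∀ x ∈ e, x ∈ U) (hU : ∀ u ∈ U, u ∈ F.good) {s s' : ℝ} (hss : s < s')
    {ω : BondConfig V}
    (h : ∃ (x y : V) (w : (fromEdgeSet (E' : Set (Sym2 V))).Walk x y),
      x ∈ U ∩ {v | s' ≤ F.rad v} ∧ y ∉ (U ∩ {v | s' ≤ F.rad v}) ∪ F.annSet s s' ∧
        (∀ z ∈ w.support, z = x ∨ z = y ∨ z ∈ F.annSet s s') ∧ ∀ e ∈ w.edges, e ∈ ω) :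
    ω ∈ F.radCross s s' := by
  obtain ⟨x, y, w, ⟨hxU, hxs⟩, hy, hs, he⟩ := h
  have hle : fromEdgeSet (E' : Set (Sym2 V)) ≤ F.graph := fun u v huv => by
    rw [fromEdgeSet_adj] at huv
    exact (fromEdgeSet_adj _).2 ⟨Finset.mem_coe.2 (hE' _ (Finset.mem_coe.1 huv.1)).1, huv.2⟩
  have hxy : x ≠ y := fun hxy => hy (Or.inl (hxy ▸ ⟨hxU, hxs⟩))
  obtain ⟨z, hz⟩ := ScaleFrame.exists_edge_end w hxy
  have hyU : y ∈ U := by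
    have h := w.edges_subset_edgeSet hz
    rw [edgeSet_fromEdgeSet] at h
    exact (hE' _ (Finset.mem_coe.1 h.1)).2 y (Sym2.mem_mk_right z y)
  have hyin : y ∈ F.inSet s := by
    refine ⟨hU y hyU, ?_⟩
    by_contra hlt
    have hlt' := lt_of_not_ge hlt
    by_cases hys : s' ≤ F.rad y
    · exact hy (Or.inl ⟨hyU, hys⟩)
    · exact hy (Or.inr ⟨hU y hyU, hlt', lt_of_not_ge hys⟩)
  have hxout : x ∈ F.outSet s s' := (F.mem_outSet_iff_of_lt hss).2 fun _ => hxs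
  refine ⟨y, x, (w.mapLe hle).reverse, hyin, hxout, ?_, ?_⟩
  · intro v hv
    rw [Walk.support_reverse, List.mem_reverse, Walk.support_mapLe_eq_support] at hv
    rcases hs v hv with h1 | h1 | h1
    · exact Or.inr (Or.inl h1)
    · exact Or.inl h1
    · exact Or.inr (Or.inr h1)
  · intro e he'
    rw [Walk.edges_reverse, List.mem_reverse, Walk.edges_mapLe_eq_edges] at he'
    exact he e he'

end ScaleFrame

end Literature.Probability.LatticeModels

end
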